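import Literature.MathematicalPhysics.StatisticalMechanics.Theil2006DefectiveBondCount
import Literature.MathematicalPhysics.StatisticalMechanics.Theil2006MainLocalEstimateAssembly
import Literature.MathematicalPhysics.StatisticalMechanics.Theil2006DistanceSet
import Literature.MathematicalPhysics.StatisticalMechanics.Theil2006SeparatedCounting
import Literature.MathematicalPhysics.StatisticalMechanics.Theil2006GroundStateEnergyReduction
import HarnessLib

/-!
# Theil 2006, §2.4 (36)–(37) and «(37) can be improved to …» (p. 12): summing the per-`λ`
estimates over `Λ ∖ {1}` and resumming with (22)

Topic `Literature/MathematicalPhysics/StatisticalMechanics`; companion of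
`Theil2006DistanceSet.lean` ((22) `V_*(s) = Σ_{λ ∈ Λ} m(λ)V(λs)` as a `HasSum`; (35) the weights
`((1 + log λ)λ⁻⁵ + λ⁻³) m(λ)` are summable over `Λ ∖ {1}`), `Theil2006DefectiveBondCount.lean`
(`𝒮 = 𝒮₀ ∪ 𝒮₁ ∪ 𝒮₂`, `#(𝒮₀ ∪ 𝒮₁) ≤ 42#∂X`, (38)) and `Theil2006MainLocalEstimateAssembly.lean`
(the pair/simplex double counting and the final assembly `mainLocalEstimate_of_parts`, whose
hypothesis `h39` is the OUTPUT of this file). Everything here is PROVED (no `sorry`, no named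
fact; D-0026). The per-`λ` inequality `P(λ)` — (31) summed over `𝒯_λ`, localized by (34), compared
by (32) and expanded by (33) — enters as a HYPOTHESIS for every `λ ∈ Λ ∖ {1}`; it is Finset
algebra over the long simplices and is assembled elsewhere from Proposition 2.9, the FJM estimate
and `Theil2006LongRange.lean`.

## Source, as printed (preprint pp. 11–12)

"(36) `½ Σ_{λ∈Λ∖{1}} Σ_{T∈𝒯_λ} Σ_{p⊂T,#p=2} e(p) ≥ ½ Σ_{λ∈Λ∖{1}} Σ_{S∈𝒯₁} Σ_{{x,x'}⊂S} V(λ|y(x) − y(x')|) m(λ)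
 − Cα Σ_{λ∈Λ∖{1}} ((1 + log(λ))λ⁻⁵ Σ_{{x,x'}∈𝒮} (|y(x) − y(x')| − 1)² + λ⁻³ #∂X) m(λ) ≥(35) […]`
Now we interchange the sum over `λ` and the sum over `S` in (36), use formula (22) and obtain the
estimate (37) `½ ΣΣΣ e(p) ≥ ½ Σ_{S∈𝒯₁} Σ_{{x,x'}⊂S} [e_*({x,x'}) − e({x,x'}) − Cα(|y(x) − y(x')| − 1)²] − Cα#∂X`.
[…] (38) […] Consequentially (37) can be improved to
`½ ΣΣΣ e(p) ≥ Σ_{{x,x'}∈𝒮} [e_*({x,x'}) − e({x,x'}) − Cα(|y(x) − y(x')| − 1)²] − Cα#∂X`. […]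
We end up with the estimate `I₁ + I₂ + I₃ ≥ Σ_{{x,x'}∈𝒮} [e_*({x,x'}) − Cα(|y(x) − y(x')| − 1)²] − Cα#∂X`."

## What is here

* `Theil2006.IsNormalized.hasSum_distSet_diff_one` — (22) with the `λ = 1` term removed:
  `Σ_{λ ∈ Λ∖{1}} m(λ) V(λ r) = V_*(r) − V(r)` (`m(1) = 1`).
* `Theil2006.IsAdmissible.shortRange_resummation` — **(36) ⇒ (37) ⇒ improved (37)**: if
  `L : Λ∖{1} → ℝ` is summable (in the application: `L(λ) = ½Σ_{T∈𝒯_λ}Σ_{p⊂T} e(p)`, finitely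
  supported) and for every `λ ∈ Λ∖{1}`
  `L(λ) ≥ ½ m(λ) Σ_{S∈𝒯₁}Σ_{p⊂S} V(λ r_p) − C α m(λ) ((1 + log λ)λ⁻⁵ Q + λ⁻³ B)`
  (`Q = Σ_{𝒮}(r_p − 1)²`, `B = #∂X`), then
  `Σ'_λ L(λ) ≥ Σ_{p∈𝒮} (e_*(p) − e(p)) − CαW·Q − (CαW + C₃₈α) B`, `W = Σ_{Λ∖{1}}` of the (35) weights,
  `C₃₈α B ≥ Σ_{𝒮₀∪𝒮₁}|e − e_*|` ((38), hypothesis instantiated by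
  `Theil2006DefectiveBondCount.exists_sum_abs_sub_le_card_defects`).
* `Theil2006.IsAdmissible.I123_ge` — **"We end up with the estimate"**: with
  `I₁ + I₂ + I₃ = Σ'_λ L(λ) + Σ_{p∈𝒮} e(p)` (the `λ = 1` part of `I₁` plus `I₂ + I₃` is `Σ_𝒮 e`,
  `Theil2006.sum_pairs_eq_half_sum_simplices_add`), `I₁ + I₂ + I₃ ≥ Σ_{𝒮}[e_*(p) − CαW(r_p − 1)²] − (CαW + C₃₈α)B`
  — the hypothesis `h39` of `IsAdmissible.mainLocalEstimate_of_parts`.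
* `Theil2006.IsAdmissible.perLambda_estimate` — **the per-`λ` inequality `P(λ)` itself** (the
  hypothesis `hP` above, for one `λ ≥ √3` and a finite family `𝒯_λ` of triples satisfying (25)),
  assembled as on pp. 10–11 from (31) per `T ∈ 𝒯_λ` and (33) per `S ∈ 𝒯₁`
  (`Theil2006LongRange`), (32) from the conclusions (26), (27) of Proposition 2.9
  (`IsAdmissible.longRangeMainTerm_ge`; (26), (27) are hypotheses), the printed (34) (hypothesis:
  Friesecke–James–Müller via Prop. 4.3, plus (28)), and «each short bond lies in at most two unit
  simplices»; constant `210 + 105 C₃₄ + C₉`. Helpers: `sum_offDiag_triple`,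
  `sum_shortRangePairs_subset_eq` (bonds `⊂ S` versus ordered pairs of `S`), `perLambda_algebra`.

* `Theil2006.exists_mainLocalEstimate_finite` — **CAPSTONE, Theorem 2.1 (9) for finite `X`**
  (`E(y) ≥ −3N + ½Σ_𝒮(e_* + 1) + ¼#∂X`, `∃ α₀(K, C₃₄, C₉, K₃) > 0`), from EXACTLY: (13); a finite
  family of triples `T` labelled by `λ(T) ∈ Λ∖{1}` with (25) (Lemma 2.7); Proposition 2.8 (1), (3);
  for every `λ ∈ Λ∖{1}`, Proposition 2.9 (26), (27) AS PRINTED (`0 ≤ #𝒯₁ − #𝒯_λ/m(λ) ≤ Cλ²#∂X`,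
  `0 ≤ Σ_{𝒯₁} meas − Σ_{𝒯_λ} meas/(λ²m(λ)) ≤ Cλ²#∂X`) and the printed (34). The split (29) of
  `E = Σ_{x<x'} e` into short and long parts, «pairs of long simplices are long», the fibrewise
  identity `Σ'_λ L(λ) = ½Σ_T Σ_{p⊂T} e(p)`, (40)–(41) (`IsAdmissible.sum_mul_ge_of_near_defects`),
  (10) and (38) are proved / taken from the tree inside.
* `Theil2006_groundStateEnergy_of_geometry` — **Theorem 1.1 from the Chapter-4 geometry**: the
  capstone, the non-negativity of the short-range and defect terms, and
  `Theil2006_groundStateEnergy_of_mainEstimate` (`Theil2006GroundStateEnergyReduction`).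

So after this file Theorem 1.1 and the finite main estimate (9) are reduced to: Lemma 2.7 / (25)
with an enumeration of `𝒯_λ(y)` by `λ ∈ Λ∖{1}`, Proposition 2.8 (1), (3), Proposition 2.9
(26)–(27) and (34) ((28) enters only through (34)) — the geometric inputs of Chapter 4 — with
constants independent of `α` and `N`.
-/

noncomputable section

open scoped BigOperators Topology
open Filter Set Metric MeasureTheory

namespace Literature.MathematicalPhysics.StatisticalMechanics

namespace Theil2006

/-! ### (22) without the `λ = 1` term -/

/-- Points of `Λ` are `≥ 1`, so off `Λ` the shell multiplicity vanishes: the support of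
`λ ↦ m(λ) F(λ)` lies in `Λ`. [cite: Theil2006, §2.3 (21)–(22) (preprint p. 8)] -/
theorem support_m_mul_subset (F : ℝ → ℝ) :
    Function.support (fun lam : ℝ => (m lam : ℝ) * F lam) ⊆ distSet := by
  intro lam hlam
  rw [Function.mem_support] at hlam
  have hm : m lam ≠ 0 := fun h0 => hlam (by rw [h0]; simp)
  obtain ⟨k, hk⟩ := m_ne_zero_iff.1 hm
  refine ⟨?_, hm⟩
  have h1 : 1 ≤ ‖triPoint k‖ := one_le_norm_triPoint hk.1
  rw [hk.2] at h1
  linarith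

/-- **(22) with the `λ = 1` term removed**: for normalized `V` and `r > 0`,
`Σ_{λ ∈ Λ∖{1}} m(λ) V(λ r) = V_*(r) − V(r)` (as a `HasSum`; `m(1) = 1`).
[cite: Theil2006, §2.3 (22) (preprint p. 8) and §2.4 (36)→(37) (p. 11)] -/
theorem IsNormalized.hasSum_distSet_diff_one {V : ℝ → ℝ} (hV : IsNormalized V) {r : ℝ}
    (hr : 0 < r) :
    HasSum (fun lam : ↥(distSet \ {1}) => (m (lam : ℝ) : ℝ) * V (lam * r))
      (renormalizedPotential V r - V r) := by
  have h0 := hV.hasSum_renormalizedPotential hr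
  have h1 : HasSum (fun lam : ℝ => (m lam : ℝ) * V (lam * r)) (renormalizedPotential V r) :=
    (hasSum_subtype_iff_of_support_subset (support_m_mul_subset fun lam => V (lam * r))).1 h0
  have hm1 : ((m (1 : ℝ) : ℕ) : ℝ) * V (1 * r) = V r := by rw [m_one, one_mul]; simp
  have h2 : HasSum (fun lam : ℝ => (m lam : ℝ) * V (lam * r) - if lam = 1 then V r else 0)
      (renormalizedPotential V r - V r) := by
    have := h1.sub (hasSum_ite_eq (1 : ℝ) (V r))
    exact this
  have hsupp : Function.support
      (fun lam : ℝ => (m lam : ℝ) * V (lam * r) - if lam = 1 then V r else 0) ⊆ distSet \ {1} := by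
    intro lam hlam
    rw [Function.mem_support] at hlam
    by_cases hl1 : lam = 1
    · subst hl1
      rw [if_pos rfl, m_one, one_mul] at hlam
      simp at hlam
    · rw [if_neg hl1, sub_zero] at hlam
      exact ⟨support_m_mul_subset (fun lam => V (lam * r)) (Function.mem_support.2 hlam),
        fun h => hl1 (mem_singleton_iff.1 h)⟩
  have h3 := (hasSum_subtype_iff_of_support_subset hsupp).2 h2
  convert h3 using 1
  ext lam
  have hne : (lam : ℝ) ≠ 1 := fun h => lam.2.2 (mem_singleton_iff.2 h)
  simp only [Function.comp_apply, if_neg hne, sub_zero]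

/-! ### (36) ⇒ (37) ⇒ the improved (37) -/

section Resummation

variable {α : ℝ} {V : ℝ → ℝ} {N : ℕ} {y : Fin N → Plane}

/-- The (35) weights dominate each of their two parts on `Λ` (`log λ ≥ 0` there). [folklore] -/
private theorem weight_parts_le (lam : ↥(distSet \ {1})) :
    0 ≤ (1 + Real.log (lam : ℝ)) * (lam : ℝ)⁻¹ ^ 5 * m (lam : ℝ) ∧
      0 ≤ (lam : ℝ)⁻¹ ^ 3 * m (lam : ℝ) ∧
      (1 + Real.log (lam : ℝ)) * (lam : ℝ)⁻¹ ^ 5 * m (lam : ℝ) ≤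
        ((1 + Real.log (lam : ℝ)) * (lam : ℝ)⁻¹ ^ 5 + (lam : ℝ)⁻¹ ^ 3) * m (lam : ℝ) ∧
      (lam : ℝ)⁻¹ ^ 3 * m (lam : ℝ) ≤
        ((1 + Real.log (lam : ℝ)) * (lam : ℝ)⁻¹ ^ 5 + (lam : ℝ)⁻¹ ^ 3) * m (lam : ℝ) := by
  have h1 : 1 ≤ (lam : ℝ) := one_le_of_mem_distSet lam.2.1
  have hlog : 0 ≤ Real.log (lam : ℝ) := Real.log_nonneg h1
  have hinv : 0 ≤ (lam : ℝ)⁻¹ := inv_nonneg.2 (by linarith)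
  have hm : (0 : ℝ) ≤ m (lam : ℝ) := Nat.cast_nonneg _
  have ha : 0 ≤ (1 + Real.log (lam : ℝ)) * (lam : ℝ)⁻¹ ^ 5 * m (lam : ℝ) :=
    mul_nonneg (mul_nonneg (by linarith) (pow_nonneg hinv 5)) hm
  have hb : 0 ≤ (lam : ℝ)⁻¹ ^ 3 * m (lam : ℝ) := mul_nonneg (pow_nonneg hinv 3) hm
  refine ⟨ha, hb, ?_, ?_⟩ <;> nlinarith

/-- **Summing the per-`λ` estimates over `Λ ∖ {1}` and resumming with (22)** ((36) ⇒ (37) ⇒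
"(37) can be improved"). Hypotheses: `V` satisfying (1)–(5), `0 < α ≤ 1/20`, `y : X_N → ℝ²`
with (13); a summable `L : Λ∖{1} → ℝ` (the left-hand sides `½Σ_{T∈𝒯_λ}Σ_{p⊂T} e(p)`) satisfying
for every `λ ∈ Λ∖{1}` the per-`λ` inequality
`L(λ) ≥ ½ m(λ) Σ_{S∈𝒯₁} Σ_{p⊂S} V(λ r_p) − Cα m(λ)((1 + log λ)λ⁻⁵ Q + λ⁻³ B)`
(`Q = Σ_{𝒮}(r_p−1)²`, `B = #∂X`); and (38) in the form `Σ_{𝒮₀∪𝒮₁}|e − e_*| ≤ C₃₈ α B`. Then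
`Σ'_λ L(λ) ≥ Σ_{p∈𝒮}(e_*(p) − e(p)) − CαW(Q + B) − C₃₈α B` with `W` the sum (35) of the weights.
[cite: Theil2006, §2.4 (36)–(38) (preprint pp. 11–12)] -/
theorem IsAdmissible.shortRange_resummation (hV : IsAdmissible α V) (hα : 0 < α)
    (hα' : α ≤ 1 / 20) (hsep : ∀ i j : Fin N, i ≠ j → 1 - α < dist (y i) (y j))
    (L : ↥(distSet \ {1}) → ℝ) (hL : Summable L) {C C₃₈ : ℝ} (hC : 0 ≤ C)
    (hP : ∀ lam : ↥(distSet \ {1}),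
      1 / 2 * (m (lam : ℝ) : ℝ) * ∑ S ∈ unitSimplices α y,
          ∑ p ∈ (shortRangePairs α y).filter (fun p => p.1 ∈ S ∧ p.2 ∈ S),
            V (lam * dist (y p.1) (y p.2)) -
        C * α * m (lam : ℝ) *
          ((1 + Real.log (lam : ℝ)) * (lam : ℝ)⁻¹ ^ 5 *
              ∑ p ∈ shortRangePairs α y, (dist (y p.1) (y p.2) - 1) ^ 2 +
            (lam : ℝ)⁻¹ ^ 3 * (defects α y).card) ≤ L lam)
    (h38 : ∑ p ∈ shortRangePairsWith α y 0 ∪ shortRangePairsWith α y 1,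
        |V (dist (y p.1) (y p.2)) - renormalizedPotential V (dist (y p.1) (y p.2))| ≤
      C₃₈ * α * (defects α y).card) :
    ∑ p ∈ shortRangePairs α y,
        (renormalizedPotential V (dist (y p.1) (y p.2)) - V (dist (y p.1) (y p.2))) -
      C * α * (∑' lam : ↥(distSet \ {1}),
          ((1 + Real.log (lam : ℝ)) * (lam : ℝ)⁻¹ ^ 5 + (lam : ℝ)⁻¹ ^ 3) * m (lam : ℝ)) *
        (∑ p ∈ shortRangePairs α y, (dist (y p.1) (y p.2) - 1) ^ 2 + (defects α y).card) -
      C₃₈ * α * (defects α y).card ≤ ∑' lam, L lam := by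
  classical
  have hQ0 : 0 ≤ ∑ p ∈ shortRangePairs α y, (dist (y p.1) (y p.2) - 1) ^ 2 :=
    Finset.sum_nonneg fun p _ => sq_nonneg _
  have hB0 : (0 : ℝ) ≤ (defects α y).card := Nat.cast_nonneg _
  -- pairs have positive length
  have hrpos : ∀ p ∈ shortRangePairs α y, 0 < dist (y p.1) (y p.2) := fun p hp => by
    have h := (mem_shortRangePairs_iff.1 hp).2.le_dist
    linarith
  -- the unit-simplex double sum is `Σ_p c(p) ·`
  have hU : ∀ g : Fin N × Fin N → ℝ, ∑ T ∈ unitSimplices α y,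
      ∑ p ∈ (shortRangePairs α y).filter (fun p => p.1 ∈ T ∧ p.2 ∈ T), g p =
        ∑ p ∈ shortRangePairs α y, (simplexCount α y p.1 p.2 : ℝ) * g p := fun g =>
    sum_simplices_pairs_eq (unitSimplices α y) (shortRangePairs α y) g
  -- (22): per pair
  have h22 : ∀ p ∈ shortRangePairs α y,
      HasSum (fun lam : ↥(distSet \ {1}) => (m (lam : ℝ) : ℝ) * V (lam * dist (y p.1) (y p.2)))
        (renormalizedPotential V (dist (y p.1) (y p.2)) - V (dist (y p.1) (y p.2))) := fun p hp =>
    hV.toIsNormalized.hasSum_distSet_diff_one (hrpos p hp)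
  -- the main term, summed over `λ`
  have hmain_eq : ∀ lam : ↥(distSet \ {1}),
      1 / 2 * (m (lam : ℝ) : ℝ) * ∑ T ∈ unitSimplices α y,
          ∑ p ∈ (shortRangePairs α y).filter (fun p => p.1 ∈ T ∧ p.2 ∈ T),
            V (lam * dist (y p.1) (y p.2)) =
        ∑ p ∈ shortRangePairs α y, 1 / 2 * (simplexCount α y p.1 p.2 : ℝ) *
          ((m (lam : ℝ) : ℝ) * V (lam * dist (y p.1) (y p.2))) := by
    intro lam
    rw [hU, Finset.mul_sum]
    exact Finset.sum_congr rfl fun p _ => by ring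
  have hmain_sum : HasSum (fun lam : ↥(distSet \ {1}) =>
      1 / 2 * (m (lam : ℝ) : ℝ) * ∑ T ∈ unitSimplices α y,
          ∑ p ∈ (shortRangePairs α y).filter (fun p => p.1 ∈ T ∧ p.2 ∈ T),
            V (lam * dist (y p.1) (y p.2)))
      (∑ p ∈ shortRangePairs α y, 1 / 2 * (simplexCount α y p.1 p.2 : ℝ) *
        (renormalizedPotential V (dist (y p.1) (y p.2)) - V (dist (y p.1) (y p.2)))) := by
    simp_rw [hmain_eq]
    exact hasSum_sum fun p hp => (h22 p hp).mul_left _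
  -- the error term, summable by (35)
  have hWsum := summable_weight_mul_m
  have herr_le : ∀ lam : ↥(distSet \ {1}),
      C * α * m (lam : ℝ) * ((1 + Real.log (lam : ℝ)) * (lam : ℝ)⁻¹ ^ 5 *
          ∑ p ∈ shortRangePairs α y, (dist (y p.1) (y p.2) - 1) ^ 2 +
            (lam : ℝ)⁻¹ ^ 3 * (defects α y).card) ≤
        C * α * (∑ p ∈ shortRangePairs α y, (dist (y p.1) (y p.2) - 1) ^ 2 + (defects α y).card) *
          (((1 + Real.log (lam : ℝ)) * (lam : ℝ)⁻¹ ^ 5 + (lam : ℝ)⁻¹ ^ 3) * m (lam : ℝ)) := by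
    intro lam
    obtain ⟨h1, h2, h3, h4⟩ := weight_parts_le lam
    have hCα : 0 ≤ C * α := mul_nonneg hC hα.le
    nlinarith [mul_le_mul_of_nonneg_left h3 (mul_nonneg hCα hQ0),
      mul_le_mul_of_nonneg_left h4 (mul_nonneg hCα hB0)]
  have herr_nonneg : ∀ lam : ↥(distSet \ {1}),
      0 ≤ C * α * m (lam : ℝ) * ((1 + Real.log (lam : ℝ)) * (lam : ℝ)⁻¹ ^ 5 *
          ∑ p ∈ shortRangePairs α y, (dist (y p.1) (y p.2) - 1) ^ 2 +
            (lam : ℝ)⁻¹ ^ 3 * (defects α y).card) := by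
    intro lam
    obtain ⟨h1, h2, -, -⟩ := weight_parts_le lam
    have hCα : 0 ≤ C * α := mul_nonneg hC hα.le
    nlinarith [mul_nonneg (mul_nonneg hCα hQ0) h1, mul_nonneg (mul_nonneg hCα hB0) h2]
  have herr_summ : Summable (fun lam : ↥(distSet \ {1}) =>
      C * α * m (lam : ℝ) * ((1 + Real.log (lam : ℝ)) * (lam : ℝ)⁻¹ ^ 5 *
          ∑ p ∈ shortRangePairs α y, (dist (y p.1) (y p.2) - 1) ^ 2 +
            (lam : ℝ)⁻¹ ^ 3 * (defects α y).card)) :=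
    Summable.of_nonneg_of_le herr_nonneg herr_le (hWsum.mul_left _)
  have herr_tsum : ∑' lam : ↥(distSet \ {1}),
      C * α * m (lam : ℝ) * ((1 + Real.log (lam : ℝ)) * (lam : ℝ)⁻¹ ^ 5 *
          ∑ p ∈ shortRangePairs α y, (dist (y p.1) (y p.2) - 1) ^ 2 +
            (lam : ℝ)⁻¹ ^ 3 * (defects α y).card) ≤
        C * α * (∑ p ∈ shortRangePairs α y, (dist (y p.1) (y p.2) - 1) ^ 2 + (defects α y).card) *
          ∑' lam : ↥(distSet \ {1}),
            ((1 + Real.log (lam : ℝ)) * (lam : ℝ)⁻¹ ^ 5 + (lam : ℝ)⁻¹ ^ 3) * m (lam : ℝ) := by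
    rw [← tsum_mul_left]
    exact herr_summ.tsum_le_tsum herr_le (hWsum.mul_left _)
  -- (36): sum the per-λ inequalities
  have h36 := (hmain_sum.summable.sub herr_summ).tsum_le_tsum hP hL
  rw [hmain_sum.summable.tsum_sub herr_summ, hmain_sum.tsum_eq] at h36
  -- (38): `½ Σ_p c(p) g(p) ≥ Σ_p g(p) − Σ_{𝒮₀∪𝒮₁} |g(p)|`
  have hc2 : ∀ p ∈ shortRangePairs α y, simplexCount α y p.1 p.2 ≤ 2 := fun p hp =>
    simplexCount_le_two hα hα' hsep (mem_shortRangePairs_iff.1 hp).2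
  have hcorr : ∑ p ∈ shortRangePairs α y,
      (renormalizedPotential V (dist (y p.1) (y p.2)) - V (dist (y p.1) (y p.2))) -
      ∑ p ∈ shortRangePairsWith α y 0 ∪ shortRangePairsWith α y 1,
        |V (dist (y p.1) (y p.2)) - renormalizedPotential V (dist (y p.1) (y p.2))| ≤
      ∑ p ∈ shortRangePairs α y, 1 / 2 * (simplexCount α y p.1 p.2 : ℝ) *
        (renormalizedPotential V (dist (y p.1) (y p.2)) - V (dist (y p.1) (y p.2))) := by
    rw [shortRangePairsWith_zero_union_one, Finset.sum_filter, ← Finset.sum_sub_distrib]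
    refine Finset.sum_le_sum fun p hp => ?_
    have h2 := hc2 p hp
    by_cases hlt : simplexCount α y p.1 p.2 < 2
    · rw [if_pos hlt, abs_sub_comm]
      have := neg_abs_le (renormalizedPotential V (dist (y p.1) (y p.2)) - V (dist (y p.1) (y p.2)))
      have := le_abs_self (renormalizedPotential V (dist (y p.1) (y p.2)) - V (dist (y p.1) (y p.2)))
      have hc0 : (0 : ℝ) ≤ simplexCount α y p.1 p.2 := Nat.cast_nonneg _
      have hc1 : (simplexCount α y p.1 p.2 : ℝ) ≤ 1 := by
        exact_mod_cast Nat.le_of_lt_succ hlt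
      nlinarith
    · have h2' : simplexCount α y p.1 p.2 = 2 := by omega
      rw [if_neg hlt, h2']
      push_cast
      linarith
  -- combine
  nlinarith [h36, herr_tsum, hcorr, h38]

/-- **"We end up with the estimate" (p. 12)**: with `I₁ + I₂ + I₃` written as
`Σ'_{λ≠1} L(λ) + [½ Σ_{S∈𝒯₁} Σ_{p⊂S} e(p) + Σ_{𝒮₀} e(p) + ½ Σ_{𝒮₁} e(p)]` (the `λ = 1` part of `I₁`
plus `I₂ + I₃`; the bracket equals `Σ_{𝒮} e(p)` since every short bond lies in at most two unit
simplices), the resummation gives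
`I₁ + I₂ + I₃ ≥ Σ_{p∈𝒮} [e_*(p) − CαW (r_p − 1)²] − (CαW + C₃₈α) #∂X` — the hypothesis `h39` of
`IsAdmissible.mainLocalEstimate_of_parts` with `C₁ = CW`, `C₂ = CW + C₃₈`.
[cite: Theil2006, §2.4 («We end up with the estimate …», preprint p. 12)] -/
theorem IsAdmissible.I123_ge (hV : IsAdmissible α V) (hα : 0 < α)
    (hα' : α ≤ 1 / 20) (hsep : ∀ i j : Fin N, i ≠ j → 1 - α < dist (y i) (y j))
    (L : ↥(distSet \ {1}) → ℝ) (hL : Summable L) {C C₃₈ : ℝ} (hC : 0 ≤ C)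
    (hP : ∀ lam : ↥(distSet \ {1}),
      1 / 2 * (m (lam : ℝ) : ℝ) * ∑ S ∈ unitSimplices α y,
          ∑ p ∈ (shortRangePairs α y).filter (fun p => p.1 ∈ S ∧ p.2 ∈ S),
            V (lam * dist (y p.1) (y p.2)) -
        C * α * m (lam : ℝ) *
          ((1 + Real.log (lam : ℝ)) * (lam : ℝ)⁻¹ ^ 5 *
              ∑ p ∈ shortRangePairs α y, (dist (y p.1) (y p.2) - 1) ^ 2 +
            (lam : ℝ)⁻¹ ^ 3 * (defects α y).card) ≤ L lam)
    (h38 : ∑ p ∈ shortRangePairsWith α y 0 ∪ shortRangePairsWith α y 1,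
        |V (dist (y p.1) (y p.2)) - renormalizedPotential V (dist (y p.1) (y p.2))| ≤
      C₃₈ * α * (defects α y).card) :
    ∑ p ∈ shortRangePairs α y, (renormalizedPotential V (dist (y p.1) (y p.2)) -
        C * (∑' lam : ↥(distSet \ {1}),
          ((1 + Real.log (lam : ℝ)) * (lam : ℝ)⁻¹ ^ 5 + (lam : ℝ)⁻¹ ^ 3) * m (lam : ℝ)) * α *
          (dist (y p.1) (y p.2) - 1) ^ 2) -
      (C * (∑' lam : ↥(distSet \ {1}),
          ((1 + Real.log (lam : ℝ)) * (lam : ℝ)⁻¹ ^ 5 + (lam : ℝ)⁻¹ ^ 3) * m (lam : ℝ)) + C₃₈) *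
        α * (defects α y).card ≤
      ∑' lam, L lam +
        (1 / 2 * ∑ T ∈ unitSimplices α y,
            ∑ p ∈ (shortRangePairs α y).filter (fun p => p.1 ∈ T ∧ p.2 ∈ T),
              V (dist (y p.1) (y p.2)) +
          ∑ p ∈ shortRangePairsWith α y 0, V (dist (y p.1) (y p.2)) +
          1 / 2 * ∑ p ∈ shortRangePairsWith α y 1, V (dist (y p.1) (y p.2))) := by
  classical
  have hres := hV.shortRange_resummation hα hα' hsep L hL hC hP h38
  -- the bracket equals `Σ_𝒮 e(p)`
  have hc2 : ∀ p ∈ shortRangePairs α y,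
      ((unitSimplices α y).filter fun T => p.1 ∈ T ∧ p.2 ∈ T).card ≤ 2 := fun p hp =>
    simplexCount_le_two hα hα' hsep (mem_shortRangePairs_iff.1 hp).2
  have hbr := sum_pairs_eq_half_sum_simplices_add (unitSimplices α y) (shortRangePairs α y)
    (fun p => V (dist (y p.1) (y p.2))) hc2
  have e0 : (shortRangePairs α y).filter
      (fun p => ((unitSimplices α y).filter fun T => p.1 ∈ T ∧ p.2 ∈ T).card = 0) =
        shortRangePairsWith α y 0 := rfl
  have e1 : (shortRangePairs α y).filter
      (fun p => ((unitSimplices α y).filter fun T => p.1 ∈ T ∧ p.2 ∈ T).card = 1) =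
        shortRangePairsWith α y 1 := rfl
  rw [e0, e1] at hbr
  rw [← hbr]
  have hsplit : ∑ p ∈ shortRangePairs α y, (renormalizedPotential V (dist (y p.1) (y p.2)) -
      C * (∑' lam : ↥(distSet \ {1}),
        ((1 + Real.log (lam : ℝ)) * (lam : ℝ)⁻¹ ^ 5 + (lam : ℝ)⁻¹ ^ 3) * m (lam : ℝ)) * α *
        (dist (y p.1) (y p.2) - 1) ^ 2) =
      ∑ p ∈ shortRangePairs α y, renormalizedPotential V (dist (y p.1) (y p.2)) -
        C * (∑' lam : ↥(distSet \ {1}),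
          ((1 + Real.log (lam : ℝ)) * (lam : ℝ)⁻¹ ^ 5 + (lam : ℝ)⁻¹ ^ 3) * m (lam : ℝ)) * α *
          ∑ p ∈ shortRangePairs α y, (dist (y p.1) (y p.2) - 1) ^ 2 := by
    rw [Finset.sum_sub_distrib, Finset.mul_sum]
  have hsub : ∑ p ∈ shortRangePairs α y,
      (renormalizedPotential V (dist (y p.1) (y p.2)) - V (dist (y p.1) (y p.2))) =
      ∑ p ∈ shortRangePairs α y, renormalizedPotential V (dist (y p.1) (y p.2)) -
        ∑ p ∈ shortRangePairs α y, V (dist (y p.1) (y p.2)) := Finset.sum_sub_distrib _ _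
  rw [hsplit]
  rw [hsub] at hres
  have hB0 : (0 : ℝ) ≤ (defects α y).card := Nat.cast_nonneg _
  nlinarith [hres]

end Resummation


/-! ### The per-`λ` inequality `P(λ)`: (31) summed over `𝒯_λ`, (34), (32) ⇐ Prop. 2.9, (33) -/

section PerLambda

variable {α : ℝ} {V : ℝ → ℝ} {N : ℕ} {y : Fin N → Plane}

/-- The sum over the ordered pairs of a three-element set, written out. [folklore] -/
private theorem sum_offDiag_triple {ι : Type*} [DecidableEq ι] {a b c : ι} (hab : a ≠ b) (hac : a ≠ c)
    (hbc : b ≠ c) (g : ι × ι → ℝ) :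
    ∑ p ∈ ({a, b, c} : Finset ι).offDiag, g p =
      g (a, b) + g (b, a) + g (a, c) + g (c, a) + g (b, c) + g (c, b) := by
  have h : ({a, b, c} : Finset ι).offDiag =
      {(a, b), (b, a), (a, c), (c, a), (b, c), (c, b)} := by
    ext ⟨u, v⟩
    simp only [Finset.mem_offDiag, Finset.mem_insert, Finset.mem_singleton, Prod.mk.injEq]
    constructor
    · rintro ⟨hu, hv, huv⟩
      rcases hu with rfl | rfl | rfl <;> rcases hv with rfl | rfl | rfl <;> simp_all
    · rintro (⟨rfl, rfl⟩ | ⟨rfl, rfl⟩ | ⟨rfl, rfl⟩ | ⟨rfl, rfl⟩ | ⟨rfl, rfl⟩ | ⟨rfl, rfl⟩) <;>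
        simp_all [ne_comm]
  rw [h, Finset.sum_insert, Finset.sum_insert, Finset.sum_insert, Finset.sum_insert,
    Finset.sum_insert, Finset.sum_singleton]
  · ring
  all_goals simp [hab, hac, hbc, hab.symm, hac.symm, hbc.symm]

/-- `y(T) = {y a, y b, y c}` for `T = {a, b, c}`. [folklore] -/
private theorem image_coe_triple {ι : Type*} [DecidableEq ι] (f : ι → Plane) (a b c : ι) :
    f '' (↑({a, b, c} : Finset ι)) = {f a, f b, f c} := by
  simp [Set.image_insert_eq]

/-- For a set `S` all of whose pairs are short-range bonds (e.g. a unit simplex) and a symmetric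
pair function `g`, the sum of `g` over the bonds `{x,x'} ∈ 𝒮`, `{x,x'} ⊂ S` (ordered pairs
`x < x'`) is half the sum over the ordered pairs of `S`. [folklore] -/
private theorem sum_shortRangePairs_subset_eq (S : Finset (Fin N))
    (hS : ∀ x ∈ S, ∀ x' ∈ S, x ≠ x' → IsShortRange α y x x') (g : Fin N × Fin N → ℝ)
    (hg : ∀ a b, g (a, b) = g (b, a)) :
    ∑ p ∈ (shortRangePairs α y).filter (fun p => p.1 ∈ S ∧ p.2 ∈ S), g p =
      1 / 2 * ∑ p ∈ S.offDiag, g p := by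
  classical
  have h1 : (shortRangePairs α y).filter (fun p => p.1 ∈ S ∧ p.2 ∈ S) =
      S.offDiag.filter (fun p => p.1 < p.2) := by
    ext ⟨u, v⟩
    simp only [Finset.mem_filter, mem_shortRangePairs_iff, Finset.mem_offDiag]
    constructor
    · rintro ⟨⟨huv, -⟩, hu, hv⟩
      exact ⟨⟨hu, hv, huv.ne⟩, huv⟩
    · rintro ⟨⟨hu, hv, hne⟩, huv⟩
      exact ⟨⟨huv, hS u hu v hv hne⟩, hu, hv⟩
  have h2 : ∑ p ∈ S.offDiag, g p = ∑ p ∈ S.offDiag.filter (fun p => p.1 < p.2), g p +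
      ∑ p ∈ S.offDiag.filter (fun p => ¬p.1 < p.2), g p :=
    (Finset.sum_filter_add_sum_filter_not _ _ _).symm
  have h3 : ∑ p ∈ S.offDiag.filter (fun p => ¬p.1 < p.2), g p =
      ∑ p ∈ S.offDiag.filter (fun p => p.1 < p.2), g p := by
    refine Finset.sum_bij' (fun p _ => p.swap) (fun p _ => p.swap) ?_ ?_ ?_ ?_ ?_
    · rintro ⟨u, v⟩ hp
      simp only [Finset.mem_filter, Finset.mem_offDiag] at hp ⊢
      obtain ⟨⟨hu, hv, hne⟩, hlt⟩ := hp
      exact ⟨⟨hv, hu, Ne.symm hne⟩, lt_of_le_of_ne (not_lt.1 hlt) (Ne.symm hne)⟩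
    · rintro ⟨u, v⟩ hp
      simp only [Finset.mem_filter, Finset.mem_offDiag] at hp ⊢
      obtain ⟨⟨hu, hv, hne⟩, hlt⟩ := hp
      exact ⟨⟨hv, hu, Ne.symm hne⟩, not_lt.2 hlt.le⟩
    · rintro ⟨u, v⟩ _; rfl
    · rintro ⟨u, v⟩ _; rfl
    · rintro ⟨u, v⟩ _; exact hg u v
  rw [h1, h2, h3]; ring

/-- `4/3 ≤ √3`. [folklore] -/
private theorem four_thirds_le_sqrt_three : (4 : ℝ) / 3 ≤ √3 := by
  rw [Real.le_sqrt (by norm_num)] <;> norm_num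

/-- The real-arithmetic skeleton of `P(λ)`: the chain (31)·Σ_T → (34) → (32) → (33)·m → «each
short bond lies in at most two unit simplices», with every sum an opaque real. [folklore] -/
private theorem perLambda_algebra {m Q B w3 w5 w7 lg α C₃₄ C₉ SumL EL MainL Main1 SV SQ : ℝ}
    (hm : 0 ≤ m) (hQ : 0 ≤ Q) (hB : 0 ≤ B) (hw3 : 0 ≤ w3) (hw5 : 0 ≤ w5) (hlg : 0 ≤ lg)
    (hα : 0 ≤ α) (hC₃₄ : 0 ≤ C₃₄) (hC₉ : 0 ≤ C₉)
    (S1 : MainL - 210 * α * w7 * EL ≤ SumL) (h34 : w7 * EL ≤ C₃₄ * w5 * lg * m * Q)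
    (S3 : m * Main1 - C₉ * α * w3 * m * B ≤ MainL) (S2 : SV - 210 * α * w5 * SQ ≤ Main1)
    (S4 : SQ ≤ 2 * Q) :
    1 / 2 * m * SV - (210 + 105 * C₃₄ + C₉) * α * m * ((1 + lg) * w5 * Q + w3 * B) ≤
      1 / 2 * SumL := by
  have e1 : 210 * α * (w7 * EL) ≤ 210 * α * (C₃₄ * w5 * lg * m * Q) :=
    mul_le_mul_of_nonneg_left h34 (by positivity)
  have e2 : m * (SV - 210 * α * w5 * SQ) ≤ m * Main1 := mul_le_mul_of_nonneg_left S2 hm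
  have e3 : 210 * α * w5 * m * SQ ≤ 210 * α * w5 * m * (2 * Q) :=
    mul_le_mul_of_nonneg_left S4 (by positivity)
  have n1 : 0 ≤ α * m * lg * w5 * Q := by positivity
  have n2 : 0 ≤ α * m * w3 * B := by positivity
  have n3 : 0 ≤ C₃₄ * α * m * w5 * Q := by positivity
  have n4 : 0 ≤ C₃₄ * α * m * w3 * B := by positivity
  have n5 : 0 ≤ C₉ * α * m * w5 * Q := by positivity
  have n6 : 0 ≤ C₉ * α * m * lg * w5 * Q := by positivity
  have n7 : 0 ≤ C₉ * α * m * w3 * B := by positivity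
  linarith [e1, e2, e3, S1, S3, n1, n2, n3, n4, n5, n6, n7]

/-- **The per-`λ` inequality `P(λ)`** (the hypothesis `hP` of `shortRange_resummation`), for one
`λ ≥ √3` and a finite family `𝒯_λ` of three-element sets (the long simplices `T ∈ 𝒯_λ(y)`) whose
pairs satisfy (25) `|(1/λ)|y(x) − y(x')| − 1| ≤ Kα` (`Kα ≤ 1/5`), assembled exactly as printed on
pp. 10–11 from: (31) for each `T ∈ 𝒯_λ` (`IsAdmissible.le_simplexEnergy`); **(34)** in the
printed form `λ⁻⁷ Σ_{T∈𝒯_λ}Σ_{p⊂T}(|y(x) − y(x')| − λ)² ≤ C₃₄ λ⁻⁵ log(λ) m(λ) Σ_{𝒮}(|y(x) − y(x')| − 1)²`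
(HYPOTHESIS — its proof is Friesecke–James–Müller [4] via Prop. 4.3 plus (28)); **(32)** via
`IsAdmissible.longRangeMainTerm_ge` from the conclusions (26), (27) of Proposition 2.9
(HYPOTHESES, `#𝒯_λ`, `Σ_{T∈𝒯_λ} meas(conv y(T))` versus `m(λ)#𝒯₁`, `λ² m(λ) Σ_{S∈𝒯₁} meas(conv y(S))`);
(33) for each `S ∈ 𝒯₁` (`IsAdmissible.scaledSimplexEnergy_le'`); and «each short bond lies in at
most two unit simplices» (`simplexCount_le_two`) for `Σ_{S∈𝒯₁}Σ_{p⊂S}(r_p − 1)² ≤ 2Σ_𝒮(r_p − 1)²`.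
Constant: `210 + 105 C₃₄ + C₉`. [cite: Theil2006, §2.4 (31)–(34), (36) (preprint pp. 10–11)] -/
theorem IsAdmissible.perLambda_estimate (hV : IsAdmissible α V) (hα : 0 < α) (hα' : α ≤ 1 / 20)
    (hsep : ∀ i j : Fin N, i ≠ j → 1 - α < dist (y i) (y j)) {lam : ℝ} (hlam : √3 ≤ lam)
    {K C₃₄ C₉ : ℝ} (hK : K * α ≤ 1 / 5) (hC₃₄ : 0 ≤ C₃₄) (hC₉ : 0 ≤ C₉)
    (TL : Finset (Finset (Fin N))) (hTL : ∀ T ∈ TL, T.card = 3)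
    (h25 : ∀ T ∈ TL, ∀ x ∈ T, ∀ x' ∈ T, x ≠ x' → |dist (y x) (y x') / lam - 1| ≤ K * α)
    (h34 : lam⁻¹ ^ 7 * ∑ T ∈ TL, (1 / 2 * ∑ p ∈ T.offDiag, (dist (y p.1) (y p.2) - lam) ^ 2) ≤
      C₃₄ * lam⁻¹ ^ 5 * Real.log lam * m lam *
        ∑ p ∈ shortRangePairs α y, (dist (y p.1) (y p.2) - 1) ^ 2)
    (h26a : 0 ≤ (m lam : ℝ) * (unitSimplices α y).card - TL.card)
    (h26b : (m lam : ℝ) * (unitSimplices α y).card - TL.card ≤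
      C₉ * lam ^ 2 * m lam * (defects α y).card)
    (h27a : 0 ≤ lam ^ 2 * m lam *
        ∑ S ∈ unitSimplices α y, (volume (convexHull ℝ (y '' ↑S))).toReal -
      ∑ T ∈ TL, (volume (convexHull ℝ (y '' ↑T))).toReal)
    (h27b : lam ^ 2 * m lam *
        ∑ S ∈ unitSimplices α y, (volume (convexHull ℝ (y '' ↑S))).toReal -
      ∑ T ∈ TL, (volume (convexHull ℝ (y '' ↑T))).toReal ≤
      C₉ * lam ^ 4 * m lam * (defects α y).card) :
    1 / 2 * (m lam : ℝ) * ∑ S ∈ unitSimplices α y,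
        ∑ p ∈ (shortRangePairs α y).filter (fun p => p.1 ∈ S ∧ p.2 ∈ S),
          V (lam * dist (y p.1) (y p.2)) -
      (210 + 105 * C₃₄ + C₉) * α * m lam *
        ((1 + Real.log lam) * lam⁻¹ ^ 5 *
            ∑ p ∈ shortRangePairs α y, (dist (y p.1) (y p.2) - 1) ^ 2 +
          lam⁻¹ ^ 3 * (defects α y).card) ≤
      1 / 2 * ∑ T ∈ TL, (1 / 2 * ∑ p ∈ T.offDiag, V (dist (y p.1) (y p.2))) := by
  classical
  have hα1 : α < 1 := by linarith
  have hα5 : α ≤ 1 / 5 := by linarith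
  have h43 : (4 : ℝ) / 3 ≤ lam := four_thirds_le_sqrt_three.trans hlam
  have hlam0 : 0 < lam := by linarith
  have hlam1 : 1 ≤ lam := by linarith
  have hm : (0 : ℝ) ≤ m lam := Nat.cast_nonneg _
  have hB : (0 : ℝ) ≤ (defects α y).card := Nat.cast_nonneg _
  have hQ : 0 ≤ ∑ p ∈ shortRangePairs α y, (dist (y p.1) (y p.2) - 1) ^ 2 :=
    Finset.sum_nonneg fun p _ => sq_nonneg _
  -- S1: (31) summed over `T ∈ 𝒯_λ`
  have S1T : ∀ T ∈ TL, 3 * V lam + 2 * √3 / lam * deriv V lam *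
      ((volume (convexHull ℝ (y '' ↑T))).toReal - √3 / 4 * lam ^ 2) -
      210 * α * lam⁻¹ ^ 7 * (1 / 2 * ∑ p ∈ T.offDiag, (dist (y p.1) (y p.2) - lam) ^ 2) ≤
      1 / 2 * ∑ p ∈ T.offDiag, V (dist (y p.1) (y p.2)) := by
    intro T hT
    have h25T := h25 T hT
    obtain ⟨a, b, c, hab, hac, hbc, rfl⟩ := Finset.card_eq_three.1 (hTL T hT)
    rw [sum_offDiag_triple hab hac hbc, sum_offDiag_triple hab hac hbc, image_coe_triple,
      volume_convexHull_triple_toReal, dist_comm (y b) (y a), dist_comm (y c) (y a),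
      dist_comm (y c) (y b)]
    have ha : a ∈ ({a, b, c} : Finset (Fin N)) := by simp
    have hb : b ∈ ({a, b, c} : Finset (Fin N)) := by simp
    have hc : c ∈ ({a, b, c} : Finset (Fin N)) := by simp
    have h := hV.le_simplexEnergy hlam ((h25T a ha b hb hab).trans hK)
      ((h25T a ha c hc hac).trans hK) ((h25T b hb c hc hbc).trans hK)
    linarith
  have S1 : (TL.card * (3 * V lam) + 2 * √3 / lam * deriv V lam *
      (∑ T ∈ TL, (volume (convexHull ℝ (y '' ↑T))).toReal - √3 / 4 * lam ^ 2 * TL.card)) -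
      210 * α * lam⁻¹ ^ 7 *
        ∑ T ∈ TL, (1 / 2 * ∑ p ∈ T.offDiag, (dist (y p.1) (y p.2) - lam) ^ 2) ≤
      ∑ T ∈ TL, (1 / 2 * ∑ p ∈ T.offDiag, V (dist (y p.1) (y p.2))) := by
    have h := Finset.sum_le_sum S1T
    rw [Finset.sum_sub_distrib, Finset.sum_add_distrib, Finset.sum_const, nsmul_eq_mul,
      ← Finset.mul_sum, ← Finset.mul_sum, Finset.sum_sub_distrib, Finset.sum_const,
      nsmul_eq_mul] at h
    linarith
  -- S3: (32) from (26), (27)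
  have S3 := hV.longRangeMainTerm_ge h43 hm hB hC₉ h26a h26b h27a h27b
  -- S2: (33) summed over `S ∈ 𝒯₁`
  have S2S : ∀ S ∈ unitSimplices α y,
      ∑ p ∈ (shortRangePairs α y).filter (fun p => p.1 ∈ S ∧ p.2 ∈ S),
          V (lam * dist (y p.1) (y p.2)) -
        210 * α * lam⁻¹ ^ 5 * ∑ p ∈ (shortRangePairs α y).filter (fun p => p.1 ∈ S ∧ p.2 ∈ S),
          (dist (y p.1) (y p.2) - 1) ^ 2 ≤
      3 * V lam + 2 * √3 * lam * deriv V lam *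
        ((volume (convexHull ℝ (y '' ↑S))).toReal - √3 / 4) := by
    intro S hS
    obtain ⟨h3, hS'⟩ := mem_unitSimplices_iff.1 hS
    have hshort : ∀ x ∈ S, ∀ x' ∈ S, x ≠ x' → IsShortRange α y x x' := by
      rcases hS' with ⟨-, h⟩ | ⟨h1, -⟩
      · exact h
      · exact absurd h1 (lt_irrefl _)
    rw [sum_shortRangePairs_subset_eq S hshort _ (fun a b => by simp [dist_comm]),
      sum_shortRangePairs_subset_eq S hshort _ (fun a b => by simp [dist_comm])]
    obtain ⟨a, b, c, hab, hac, hbc, rfl⟩ := Finset.card_eq_three.1 h3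
    rw [sum_offDiag_triple hab hac hbc, sum_offDiag_triple hab hac hbc, image_coe_triple,
      volume_convexHull_triple_toReal, dist_comm (y b) (y a), dist_comm (y c) (y a),
      dist_comm (y c) (y b)]
    have ha : a ∈ ({a, b, c} : Finset (Fin N)) := by simp
    have hb : b ∈ ({a, b, c} : Finset (Fin N)) := by simp
    have hc : c ∈ ({a, b, c} : Finset (Fin N)) := by simp
    have e1 : |dist (y a) (y b) - 1| ≤ 1 / 5 :=
      (show |dist (y a) (y b) - 1| ≤ α from hshort a ha b hb hab).trans hα5
    have e2 : |dist (y a) (y c) - 1| ≤ 1 / 5 :=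
      (show |dist (y a) (y c) - 1| ≤ α from hshort a ha c hc hac).trans hα5
    have e3 : |dist (y b) (y c) - 1| ≤ 1 / 5 :=
      (show |dist (y b) (y c) - 1| ≤ α from hshort b hb c hc hbc).trans hα5
    have h := hV.scaledSimplexEnergy_le' hlam e1 e2 e3
    linarith
  have S2 : ∑ S ∈ unitSimplices α y,
      ∑ p ∈ (shortRangePairs α y).filter (fun p => p.1 ∈ S ∧ p.2 ∈ S),
        V (lam * dist (y p.1) (y p.2)) -
      210 * α * lam⁻¹ ^ 5 * ∑ S ∈ unitSimplices α y,
        ∑ p ∈ (shortRangePairs α y).filter (fun p => p.1 ∈ S ∧ p.2 ∈ S),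
          (dist (y p.1) (y p.2) - 1) ^ 2 ≤
      (unitSimplices α y).card * (3 * V lam) + 2 * √3 * lam * deriv V lam *
        (∑ S ∈ unitSimplices α y, (volume (convexHull ℝ (y '' ↑S))).toReal -
          √3 / 4 * (unitSimplices α y).card) := by
    have h := Finset.sum_le_sum S2S
    rw [Finset.sum_sub_distrib, Finset.sum_add_distrib, Finset.sum_const, nsmul_eq_mul,
      ← Finset.mul_sum, ← Finset.mul_sum, Finset.sum_sub_distrib, Finset.sum_const,
      nsmul_eq_mul] at h
    linarith
  -- S4: each short bond lies in at most two unit simplices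
  have S4 : ∑ S ∈ unitSimplices α y,
      ∑ p ∈ (shortRangePairs α y).filter (fun p => p.1 ∈ S ∧ p.2 ∈ S),
        (dist (y p.1) (y p.2) - 1) ^ 2 ≤
      2 * ∑ p ∈ shortRangePairs α y, (dist (y p.1) (y p.2) - 1) ^ 2 := by
    rw [sum_simplices_pairs_eq (unitSimplices α y) (shortRangePairs α y), Finset.mul_sum]
    refine Finset.sum_le_sum fun p hp => ?_
    have h2 : (((unitSimplices α y).filter fun T => p.1 ∈ T ∧ p.2 ∈ T).card : ℝ) ≤ 2 := by
      exact_mod_cast simplexCount_le_two hα hα' hsep (mem_shortRangePairs_iff.1 hp).2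
    nlinarith [sq_nonneg (dist (y p.1) (y p.2) - 1)]
  -- combine
  have key := perLambda_algebra (w7 := lam⁻¹ ^ 7) hm hQ hB (pow_nonneg (inv_nonneg.2 hlam0.le) 3)
    (pow_nonneg (inv_nonneg.2 hlam0.le) 5) (Real.log_nonneg hlam1) hα.le hC₃₄ hC₉ S1 h34 S3 S2 S4
  linarith [key]

end PerLambda


/-! ### Capstone: the main estimate (9) for finite `X`, from the Chapter-4 geometry -/

section Capstone

variable {α : ℝ} {V : ℝ → ℝ} {N : ℕ} {y : Fin N → Plane}

/-- `E(y) = Σ_{x<x'} e({x,x'})`: the tree's `interactionEnergy` as a sum over ordered pairs.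
[cite: Theil2006, §1 (definition of E, preprint p. 2)] -/
theorem interactionEnergy_eq_sum_ltPairs (V : ℝ → ℝ) (y : Fin N → Plane) :
    interactionEnergy V y =
      ∑ p ∈ (Finset.univ : Finset (Fin N × Fin N)).filter (fun p => p.1 < p.2),
        V (dist (y p.1) (y p.2)) := by
  rw [interactionEnergy, Finset.sum_filter, ← Finset.univ_product_univ, Finset.sum_product]
  refine Finset.sum_congr rfl fun i _ => ?_
  rw [← Finset.sum_filter]
  congr 1
  ext j
  simp

/-- Short bonds are ordered pairs. [folklore] -/
private theorem shortRangePairs_subset_pairs :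
    shortRangePairs α y ⊆ (Finset.univ : Finset (Fin N × Fin N)).filter (fun p => p.1 < p.2) :=
  fun _ hp => Finset.mem_filter.2 ⟨Finset.mem_univ _, (mem_shortRangePairs_iff.1 hp).1⟩

/-- For a set `T` all of whose pairs belong to a family `Pr` of ordered pairs `x < x'` exactly when
`x < x'`, the sum over the `Pr`-pairs inside `T` is half the sum over the ordered pairs of `T`.
[folklore] -/
private theorem sum_pairs_subset_eq_half_offDiag (Pr : Finset (Fin N × Fin N))
    (hPr : ∀ p ∈ Pr, p.1 ≠ p.2) (T : Finset (Fin N))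
    (hT : ∀ u ∈ T, ∀ v ∈ T, u ≠ v → ((u, v) ∈ Pr ↔ u < v)) (g : Fin N × Fin N → ℝ)
    (hg : ∀ a b, g (a, b) = g (b, a)) :
    ∑ p ∈ Pr.filter (fun p => p.1 ∈ T ∧ p.2 ∈ T), g p = 1 / 2 * ∑ p ∈ T.offDiag, g p := by
  classical
  have h1 : Pr.filter (fun p => p.1 ∈ T ∧ p.2 ∈ T) = T.offDiag.filter (fun p => p.1 < p.2) := by
    ext ⟨u, v⟩
    simp only [Finset.mem_filter, Finset.mem_offDiag]
    constructor
    · rintro ⟨hp, hu, hv⟩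
      have hne : u ≠ v := hPr (u, v) hp
      exact ⟨⟨hu, hv, hne⟩, (hT u hu v hv hne).1 hp⟩
    · rintro ⟨⟨hu, hv, hne⟩, huv⟩
      exact ⟨(hT u hu v hv hne).2 huv, hu, hv⟩
  have h2 : ∑ p ∈ T.offDiag, g p = ∑ p ∈ T.offDiag.filter (fun p => p.1 < p.2), g p +
      ∑ p ∈ T.offDiag.filter (fun p => ¬p.1 < p.2), g p :=
    (Finset.sum_filter_add_sum_filter_not _ _ _).symm
  have h3 : ∑ p ∈ T.offDiag.filter (fun p => ¬p.1 < p.2), g p =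
      ∑ p ∈ T.offDiag.filter (fun p => p.1 < p.2), g p := by
    refine Finset.sum_bij' (fun p _ => p.swap) (fun p _ => p.swap) ?_ ?_ ?_ ?_ ?_
    · rintro ⟨u, v⟩ hp
      simp only [Finset.mem_filter, Finset.mem_offDiag] at hp ⊢
      obtain ⟨⟨hu, hv, hne⟩, hlt⟩ := hp
      exact ⟨⟨hv, hu, Ne.symm hne⟩, lt_of_le_of_ne (not_lt.1 hlt) (Ne.symm hne)⟩
    · rintro ⟨u, v⟩ hp
      simp only [Finset.mem_filter, Finset.mem_offDiag] at hp ⊢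
      obtain ⟨⟨hu, hv, hne⟩, hlt⟩ := hp
      exact ⟨⟨hv, hu, Ne.symm hne⟩, not_lt.2 hlt.le⟩
    · rintro ⟨u, v⟩ _; rfl
    · rintro ⟨u, v⟩ _; rfl
    · rintro ⟨u, v⟩ _; exact hg u v
  rw [h1, h2, h3]; ring

/-- `0 ≤ a − b/μ ≤ c` multiplied through by `μ > 0`. [folklore] -/
private theorem mul_form_of_div_form {a b c μ : ℝ} (hμ : 0 < μ) (h1 : 0 ≤ a - 1 / μ * b)
    (h2 : a - 1 / μ * b ≤ c) : 0 ≤ μ * a - b ∧ μ * a - b ≤ μ * c := by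
  have e : μ * (a - 1 / μ * b) = μ * a - b := by field_simp
  constructor
  · rw [← e]; exact mul_nonneg hμ.le h1
  · rw [← e]; exact mul_le_mul_of_nonneg_left h2 hμ.le

/-- **Theil 2006, the main estimate (9) for finite configurations, from the geometric inputs of
Chapter 4.** For constants `K, C₃₄, C₉, K₃ ≥ 0` there is `α₀ > 0` such that for `0 < α < α₀`,
every `V` satisfying (1)–(5), every `y : X_N → ℝ²` with (13), and every finite family of long
simplices `𝒯_λ(y)` (triples `T` labelled by `λ(T) ∈ Λ∖{1}`) satisfying
(25) `|(1/λ)|y(x) − y(x')| − 1| ≤ Kα` on each `T` (Lemma 2.7),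
Proposition 2.8 (1) (every long pair lies in at most two of them) and (3) (a long pair in fewer
than two of them has a defect within `K₃|y(x) − y(x')|` of `y(x)`),
Proposition 2.9 (26), (27) for every `λ`, and (34) for every `λ` (Friesecke–James–Müller), one has
`E(y) ≥ −3N + ½ Σ_{𝒮} (e_*({x,x'}) + 1) + ¼ #∂X` — (9) with the non-negative short-range term in
place of the printed `−#𝒮` (see `Theil2006MainLocalEstimateAssembly`). Proof: the proved chain
`perLambda_estimate → shortRange_resummation → I123_ge → mainLocalEstimate_of_parts`, the split
(29) of `E` (`sum_pairs_eq_half_sum_simplices_add` for the unit and for the long simplices), and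
(40)–(41) (`IsAdmissible.sum_mul_ge_of_near_defects`) for `I₄ + I₅`; (10) and (38) from the tree.
[cite: Theil2006, Theorem 2.1 (9) (preprint p. 5), §2.3–2.4 (pp. 9–12)] -/
theorem exists_mainLocalEstimate_finite {K C₃₄ C₉ K₃ : ℝ} (hK : 0 ≤ K) (hC₃₄ : 0 ≤ C₃₄)
    (hC₉ : 0 ≤ C₉) (hK₃ : 0 ≤ K₃) :
    ∃ α₀ : ℝ, 0 < α₀ ∧ ∀ ⦃α : ℝ⦄, 0 < α → α < α₀ → ∀ ⦃V : ℝ → ℝ⦄, IsAdmissible α V →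
      ∀ {N : ℕ} (y : Fin N → Plane), (∀ i j : Fin N, i ≠ j → 1 - α < dist (y i) (y j)) →
      ∀ (TLall : Finset (Finset (Fin N))) (lamOf : Finset (Fin N) → ℝ),
        (∀ T ∈ TLall, lamOf T ∈ distSet \ {1}) → (∀ T ∈ TLall, T.card = 3) →
        (∀ T ∈ TLall, ∀ x ∈ T, ∀ x' ∈ T, x ≠ x' →
          |dist (y x) (y x') / lamOf T - 1| ≤ K * α) →
        (∀ p ∈ (Finset.univ : Finset (Fin N × Fin N)).filter (fun p => p.1 < p.2) \
            shortRangePairs α y, (TLall.filter fun T => p.1 ∈ T ∧ p.2 ∈ T).card ≤ 2) →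
        (∀ p ∈ (Finset.univ : Finset (Fin N × Fin N)).filter (fun p => p.1 < p.2) \
            shortRangePairs α y, (TLall.filter fun T => p.1 ∈ T ∧ p.2 ∈ T).card < 2 →
            ∃ b ∈ defects α y, dist (y p.1) (y b) ≤ K₃ * dist (y p.1) (y p.2)) →
        (∀ lam : ↥(distSet \ {1}),
          (0 ≤ ((unitSimplices α y).card : ℝ) -
              1 / (m (lam : ℝ) : ℝ) * (TLall.filter fun T => lamOf T = lam).card ∧
            ((unitSimplices α y).card : ℝ) -
              1 / (m (lam : ℝ) : ℝ) * (TLall.filter fun T => lamOf T = lam).card ≤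
              C₉ * (lam : ℝ) ^ 2 * (defects α y).card) ∧
          (0 ≤ ∑ S ∈ unitSimplices α y, (volume (convexHull ℝ (y '' ↑S))).toReal -
              1 / ((lam : ℝ) ^ 2 * m (lam : ℝ)) *
                ∑ T ∈ TLall.filter (fun T => lamOf T = lam),
                  (volume (convexHull ℝ (y '' ↑T))).toReal ∧
            ∑ S ∈ unitSimplices α y, (volume (convexHull ℝ (y '' ↑S))).toReal -
              1 / ((lam : ℝ) ^ 2 * m (lam : ℝ)) *
                ∑ T ∈ TLall.filter (fun T => lamOf T = lam),
                  (volume (convexHull ℝ (y '' ↑T))).toReal ≤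
              C₉ * (lam : ℝ) ^ 2 * (defects α y).card) ∧
          (lam : ℝ)⁻¹ ^ 7 * ∑ T ∈ TLall.filter (fun T => lamOf T = lam),
              (1 / 2 * ∑ p ∈ T.offDiag, (dist (y p.1) (y p.2) - lam) ^ 2) ≤
            C₃₄ * (lam : ℝ)⁻¹ ^ 5 * Real.log (lam : ℝ) * m (lam : ℝ) *
              ∑ p ∈ shortRangePairs α y, (dist (y p.1) (y p.2) - 1) ^ 2) →
        -3 * (N : ℝ) + 1 / 2 * ∑ p ∈ shortRangePairs α y,
            (renormalizedPotential V (dist (y p.1) (y p.2)) + 1) + 1 / 4 * (defects α y).card ≤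
          interactionEnergy V y := by
  classical
  -- constants
  obtain ⟨C₃₈, hC₃₈, h38⟩ := exists_sum_abs_sub_le_card_defects
  obtain ⟨αq, hαq, hquad⟩ := exists_quadratic_le_renormalizedPotential
  set W : ℝ := ∑' lam : ↥(distSet \ {1}),
    ((1 + Real.log (lam : ℝ)) * (lam : ℝ)⁻¹ ^ 5 + (lam : ℝ)⁻¹ ^ 3) * m (lam : ℝ) with hW
  have hW0 : 0 ≤ W := tsum_nonneg fun lam => weight_mul_m_nonneg (lam : ℝ)
  set C : ℝ := 210 + 105 * C₃₄ + C₉ with hCdef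
  have hC0 : 0 ≤ C := by rw [hCdef]; positivity
  set C₃ : ℝ := 10240 * (2 * K₃ + 1) ^ 2 with hC₃
  have hC₃0 : 0 ≤ C₃ := by rw [hC₃]; positivity
  refine ⟨min (min (1 / 200) αq) (min (1 / (5 * K + 1))
      (min (1 / (8 * (C * W) + 1)) (1 / (4 * (C * W + C₃₈ + 2 * C₃) + 1)))), by positivity, ?_⟩
  intro α hα hα0 V hV N y hsep TLall lamOf hlam hTL3 h25 h281 h283 hgeom
  have hα200 : α ≤ 1 / 200 := hα0.le.trans ((min_le_left _ _).trans (min_le_left _ _))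
  have hαq' : α < αq := hα0.trans_le ((min_le_left _ _).trans (min_le_right _ _))
  have hαK : α ≤ 1 / (5 * K + 1) := hα0.le.trans ((min_le_right _ _).trans (min_le_left _ _))
  have hα8 : α ≤ 1 / (8 * (C * W) + 1) :=
    hα0.le.trans ((min_le_right _ _).trans ((min_le_right _ _).trans (min_le_left _ _)))
  have hα4 : α ≤ 1 / (4 * (C * W + C₃₈ + 2 * C₃) + 1) :=
    hα0.le.trans ((min_le_right _ _).trans ((min_le_right _ _).trans (min_le_right _ _)))
  have hKα : K * α ≤ 1 / 5 := by
    have h1 : K * α ≤ K * (1 / (5 * K + 1)) := mul_le_mul_of_nonneg_left hαK hK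
    have h2 : K * (1 / (5 * K + 1)) ≤ 1 / 5 := by
      rw [mul_one_div, div_le_div_iff₀ (by positivity) (by norm_num)]
      linarith
    linarith
  have hsmall₁ : 8 * (C * W) * α ≤ 1 := by
    have h1 : 8 * (C * W) * α ≤ 8 * (C * W) * (1 / (8 * (C * W) + 1)) :=
      mul_le_mul_of_nonneg_left hα8 (by positivity)
    have h2 : 8 * (C * W) * (1 / (8 * (C * W) + 1)) ≤ 1 := by
      rw [mul_one_div, div_le_one (by positivity)]
      linarith
    linarith
  have hsmall₂ : 4 * (C * W + C₃₈ + 2 * C₃) * α ≤ 1 := by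
    have h1 : 4 * (C * W + C₃₈ + 2 * C₃) * α ≤
        4 * (C * W + C₃₈ + 2 * C₃) * (1 / (4 * (C * W + C₃₈ + 2 * C₃) + 1)) :=
      mul_le_mul_of_nonneg_left hα4 (by positivity)
    have h2 : 4 * (C * W + C₃₈ + 2 * C₃) * (1 / (4 * (C * W + C₃₈ + 2 * C₃) + 1)) ≤ 1 := by
      rw [mul_one_div, div_le_one (by positivity)]
      linarith
    linarith
  have hα1 : α < 1 := by linarith
  have hα20 : α ≤ 1 / 20 := by linarith
  -- notation
  set Pall := (Finset.univ : Finset (Fin N × Fin N)).filter (fun p => p.1 < p.2) with hPall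
  set LP := Pall \ shortRangePairs α y with hLP
  set e : Fin N × Fin N → ℝ := fun p => V (dist (y p.1) (y p.2)) with he
  set TL : ↥(distSet \ {1}) → Finset (Finset (Fin N)) :=
    fun lam => TLall.filter fun T => lamOf T = lam with hTLdef
  set L : ↥(distSet \ {1}) → ℝ :=
    fun lam => 1 / 2 * ∑ T ∈ TL lam, (1 / 2 * ∑ p ∈ T.offDiag, e p) with hLdef
  -- pairs of long simplices are long pairs
  have hlongT : ∀ T ∈ TLall, ∀ u ∈ T, ∀ v ∈ T, u ≠ v → ¬IsShortRange α y u v := by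
    intro T hT u hu v hv huv hsr
    have hl := hlam T hT
    have h3 : √3 ≤ lamOf T := sqrt_three_le_of_mem_distSet hl.1 (fun h => hl.2 h)
    have h53 : (5 : ℝ) / 3 < √3 := by
      rw [show (5 : ℝ) / 3 = √(25 / 9) by
        rw [show (25 : ℝ) / 9 = (5 / 3) ^ 2 by norm_num, Real.sqrt_sq (by norm_num)]]
      exact Real.sqrt_lt_sqrt (by norm_num) (by norm_num)
    have hl0 : 0 < lamOf T := by linarith
    have h := (abs_le.1 ((h25 T hT u hu v hv huv).trans hKα)).1
    have hd : 4 / 5 * lamOf T ≤ dist (y u) (y v) := by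
      have : 4 / 5 ≤ dist (y u) (y v) / lamOf T := by linarith
      rwa [le_div_iff₀ hl0] at this
    have hs := (show |dist (y u) (y v) - 1| ≤ α from hsr)
    have := (abs_le.1 hs).2
    linarith
  have hLPiff : ∀ T ∈ TLall, ∀ u ∈ T, ∀ v ∈ T, u ≠ v → ((u, v) ∈ LP ↔ u < v) := by
    intro T hT u hu v hv huv
    rw [hLP, Finset.mem_sdiff, hPall, Finset.mem_filter, mem_shortRangePairs_iff]
    constructor
    · rintro ⟨⟨-, h⟩, -⟩; exact h
    · intro h; exact ⟨⟨Finset.mem_univ _, h⟩, fun h' => hlongT T hT u hu v hv huv h'.2⟩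
  -- long pairs are `> 1 + α` apart
  have hLPlong : ∀ p ∈ LP, 1 + α ≤ dist (y p.1) (y p.2) := by
    intro p hp
    rw [hLP, Finset.mem_sdiff, hPall, Finset.mem_filter, mem_shortRangePairs_iff] at hp
    obtain ⟨⟨-, hlt⟩, hns⟩ := hp
    have hns' : ¬|dist (y p.1) (y p.2) - 1| ≤ α := fun h => hns ⟨hlt, h⟩
    rw [not_le, lt_abs] at hns'
    have hd := hsep p.1 p.2 (ne_of_lt hlt)
    rcases hns' with h | h <;> linarith
  have hLPne : ∀ p ∈ LP, p.1 ≠ p.2 := fun p hp =>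
    ne_of_lt (Finset.mem_filter.1 (Finset.mem_sdiff.1 hp).1).2
  -- the split (29) of `E`: short part and long part
  have hE : interactionEnergy V y = ∑ p ∈ shortRangePairs α y, e p + ∑ p ∈ LP, e p := by
    rw [interactionEnergy_eq_sum_ltPairs, ← Finset.sum_sdiff shortRangePairs_subset_pairs, add_comm]
  have hc2S : ∀ p ∈ shortRangePairs α y,
      ((unitSimplices α y).filter fun T => p.1 ∈ T ∧ p.2 ∈ T).card ≤ 2 := fun p hp =>
    simplexCount_le_two hα hα20 hsep (mem_shortRangePairs_iff.1 hp).2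
  have hshort := sum_pairs_eq_half_sum_simplices_add (unitSimplices α y) (shortRangePairs α y) e hc2S
  have hlong := sum_pairs_eq_half_sum_simplices_add TLall LP e h281
  -- the long-simplex part is `Σ'_λ L(λ)`
  set Λf : Finset ↥(distSet \ {1}) :=
    TLall.attach.image fun T => ⟨lamOf T.1, hlam T.1 T.2⟩ with hΛf
  have hTL_empty : ∀ lam ∉ Λf, TL lam = ∅ := by
    intro lam hlam'
    rw [hTLdef]
    refine Finset.filter_eq_empty_iff.2 fun T hT hTl => hlam' ?_
    rw [hΛf, Finset.mem_image]
    exact ⟨⟨T, hT⟩, Finset.mem_attach _ _, Subtype.ext hTl⟩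
  have hL0 : ∀ lam ∉ Λf, L lam = 0 := fun lam hlam' => by
    simp only [hLdef, hTL_empty lam hlam', Finset.sum_empty, mul_zero]
  have hLsum : Summable L := summable_of_ne_finset_zero hL0
  have hLtsum : ∑' lam, L lam = 1 / 2 * ∑ T ∈ TLall,
      ∑ p ∈ LP.filter (fun p => p.1 ∈ T ∧ p.2 ∈ T), e p := by
    rw [tsum_eq_sum hL0]
    -- `Σ_{λ ∈ Λf} L(λ) = ½ Σ_{T ∈ TLall} ½ Σ_{T.offDiag} e`
    have hfib : ∑ lam ∈ Λf, ∑ T ∈ TL lam, (1 / 2 * ∑ p ∈ T.offDiag, e p) =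
        ∑ T ∈ TLall, (1 / 2 * ∑ p ∈ T.offDiag, e p) := by
      have h1 : ∑ lam ∈ Λf, ∑ T ∈ TL lam, (1 / 2 * ∑ p ∈ T.offDiag, e p) =
          ∑ r ∈ Λf.image Subtype.val, ∑ T ∈ TLall.filter (fun T => lamOf T = r),
            (1 / 2 * ∑ p ∈ T.offDiag, e p) := by
        rw [Finset.sum_image fun a _ b _ h => Subtype.ext h]
      rw [h1]
      refine Finset.sum_fiberwise_of_maps_to (fun T hT => ?_) _
      rw [Finset.mem_image]
      exact ⟨⟨lamOf T, hlam T hT⟩, by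
        rw [hΛf, Finset.mem_image]
        exact ⟨⟨T, hT⟩, Finset.mem_attach _ _, rfl⟩, rfl⟩
    have hrepr : ∀ T ∈ TLall, ∑ p ∈ LP.filter (fun p => p.1 ∈ T ∧ p.2 ∈ T), e p =
        1 / 2 * ∑ p ∈ T.offDiag, e p := fun T hT =>
      sum_pairs_subset_eq_half_offDiag LP hLPne T (hLPiff T hT) e (fun a b => by simp [he, dist_comm])
    rw [Finset.sum_congr rfl hrepr, ← hfib, Finset.mul_sum]
  -- h39 via the resummation chain
  have hP : ∀ lam : ↥(distSet \ {1}),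
      1 / 2 * (m (lam : ℝ) : ℝ) * ∑ S ∈ unitSimplices α y,
          ∑ p ∈ (shortRangePairs α y).filter (fun p => p.1 ∈ S ∧ p.2 ∈ S),
            V (lam * dist (y p.1) (y p.2)) -
        C * α * m (lam : ℝ) *
          ((1 + Real.log (lam : ℝ)) * (lam : ℝ)⁻¹ ^ 5 *
              ∑ p ∈ shortRangePairs α y, (dist (y p.1) (y p.2) - 1) ^ 2 +
            (lam : ℝ)⁻¹ ^ 3 * (defects α y).card) ≤ L lam := by
    intro lam
    obtain ⟨⟨p26a, p26b⟩, ⟨p27a, p27b⟩, h34⟩ := hgeom lam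
    have hl3 : √3 ≤ (lam : ℝ) := sqrt_three_le_of_mem_distSet lam.2.1 (fun h => lam.2.2 h)
    -- the printed (26), (27) multiplied through by `m(λ)`, `λ² m(λ)`
    have hm0 : (0 : ℝ) < m (lam : ℝ) := by exact_mod_cast Nat.pos_of_ne_zero lam.2.1.2
    have hl0 : (0 : ℝ) < (lam : ℝ) := lam.2.1.1
    obtain ⟨h26a, h26b'⟩ := mul_form_of_div_form hm0 p26a p26b
    obtain ⟨h27a, h27b'⟩ := mul_form_of_div_form (by positivity : (0 : ℝ) < (lam : ℝ) ^ 2 * m (lam : ℝ))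
      p27a p27b
    have h26b : (m (lam : ℝ) : ℝ) * (unitSimplices α y).card -
        (TLall.filter fun T => lamOf T = lam).card ≤
        C₉ * (lam : ℝ) ^ 2 * m (lam : ℝ) * (defects α y).card := by
      refine h26b'.trans (le_of_eq ?_); ring
    have h27b : (lam : ℝ) ^ 2 * m (lam : ℝ) *
          ∑ S ∈ unitSimplices α y, (volume (convexHull ℝ (y '' ↑S))).toReal -
        ∑ T ∈ TLall.filter (fun T => lamOf T = lam), (volume (convexHull ℝ (y '' ↑T))).toReal ≤
        C₉ * (lam : ℝ) ^ 4 * m (lam : ℝ) * (defects α y).card := by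
      refine h27b'.trans (le_of_eq ?_); ring
    have h25' : ∀ T ∈ TL lam, ∀ x ∈ T, ∀ x' ∈ T, x ≠ x' →
        |dist (y x) (y x') / lam - 1| ≤ K * α := by
      intro T hT x hx x' hx' hxx'
      rw [hTLdef, Finset.mem_filter] at hT
      rw [← hT.2]
      exact h25 T hT.1 x hx x' hx' hxx'
    have hTL3' : ∀ T ∈ TL lam, T.card = 3 := fun T hT =>
      hTL3 T (Finset.mem_filter.1 hT).1
    exact hV.perLambda_estimate hα hα20 hsep hl3 hKα hC₃₄ hC₉ (TL lam) hTL3' h25' h34 h26a h26b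
      h27a h27b
  have h38' := h38 hα hα200 hV y hsep
  have h123 := hV.I123_ge hα hα20 hsep L hLsum hC0 hP h38'
  -- I₄ + I₅
  have hnear : ∀ j : ℕ, j < 2 → ∀ p ∈ LP.filter (fun p =>
      (TLall.filter fun T => p.1 ∈ T ∧ p.2 ∈ T).card = j),
      ∃ b ∈ defects α y, dist (y p.1) (y b) ≤ K₃ * dist (y p.1) (y p.2) := by
    intro j hj p hp
    rw [Finset.mem_filter] at hp
    exact h283 p hp.1 (by rw [hp.2]; exact hj)
  have h40 := hV.sum_mul_ge_of_near_defects hα (by linarith) hsep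
    (LP.filter fun p => (TLall.filter fun T => p.1 ∈ T ∧ p.2 ∈ T).card = 0)
    (fun p hp => hLPlong p (Finset.mem_filter.1 hp).1) hK₃ (hnear 0 (by norm_num))
    (w := fun _ => 1) (fun _ _ => zero_le_one) (fun _ _ => le_rfl)
  have h41 := hV.sum_mul_ge_of_near_defects hα (by linarith) hsep
    (LP.filter fun p => (TLall.filter fun T => p.1 ∈ T ∧ p.2 ∈ T).card = 1)
    (fun p hp => hLPlong p (Finset.mem_filter.1 hp).1) hK₃ (hnear 1 (by norm_num))
    (w := fun _ => 1 / 2) (fun _ _ => by norm_num) (fun _ _ => by norm_num)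
  simp only [one_mul] at h40
  rw [← Finset.mul_sum] at h41
  -- assemble
  have hsplit : interactionEnergy V y =
      (∑' lam, L lam +
        (1 / 2 * ∑ T ∈ unitSimplices α y,
            ∑ p ∈ (shortRangePairs α y).filter (fun p => p.1 ∈ T ∧ p.2 ∈ T), e p +
          ∑ p ∈ shortRangePairsWith α y 0, e p +
          1 / 2 * ∑ p ∈ shortRangePairsWith α y 1, e p)) +
      (∑ p ∈ LP.filter (fun p => (TLall.filter fun T => p.1 ∈ T ∧ p.2 ∈ T).card = 0), e p +
        1 / 2 * ∑ p ∈ LP.filter (fun p => (TLall.filter fun T => p.1 ∈ T ∧ p.2 ∈ T).card = 1),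
          e p) := by
    rw [hE, hshort, hlong, hLtsum]
    have e0 : (shortRangePairs α y).filter
        (fun p => ((unitSimplices α y).filter fun T => p.1 ∈ T ∧ p.2 ∈ T).card = 0) =
          shortRangePairsWith α y 0 := rfl
    have e1 : (shortRangePairs α y).filter
        (fun p => ((unitSimplices α y).filter fun T => p.1 ∈ T ∧ p.2 ∈ T).card = 1) =
          shortRangePairsWith α y 1 := rfl
    rw [e0, e1]
    ring
  have hD : (0 : ℝ) ≤ (defects α y).card := Nat.cast_nonneg _
  have h4145 : -((2 * C₃) * α * (defects α y).card) ≤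
      ∑ p ∈ LP.filter (fun p => (TLall.filter fun T => p.1 ∈ T ∧ p.2 ∈ T).card = 0), e p +
        1 / 2 * ∑ p ∈ LP.filter (fun p => (TLall.filter fun T => p.1 ∈ T ∧ p.2 ∈ T).card = 1),
          e p := by
    simp only [he] at h40 h41 ⊢
    rw [hC₃]
    linarith
  exact hV.mainLocalEstimate_of_parts hα (by linarith) hsep (hquad α V hα hαq' hV)
    (mul_nonneg hC0 hW0) hsplit h123 h4145 hsmall₁ (by linarith)

end Capstone

end Theil2006

/-! ### Theorem 1.1 from the Chapter-4 geometry -/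

open Theil2006 MeasureTheory in
/-- **Theil 2006, Theorem 1.1 from the geometric inputs of Chapter 4.** If for all small `α`,
every `V` satisfying (1)–(5) and every configuration with (13), the long simplices `𝒯_λ(y)` can
be enumerated (triples labelled by `λ ∈ Λ∖{1}`) so that (25) (Lemma 2.7), Proposition 2.8 (1), (3),
Proposition 2.9 (26), (27) and (34) hold with constants `K, C₃₄, C₉, K₃` independent of `α`, `N`,
then Theorem 1.1 (`Theil2006_groundStateEnergy`: `lim_N min_y E(y)/N = −3`) holds. Proof:
`exists_mainLocalEstimate_finite` gives (9), whose short-range and defect terms are non-negative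
((10) on `(1−α, 1+α]`), hence `E(y) ≥ −3N` under (13); then
`Theil2006_groundStateEnergy_of_mainEstimate` ((13)-reduction + the proved upper bound).
[cite: Theil2006, §2.1 (Theorem 1.1 from Theorem 2.1, preprint p. 5); §2.3–2.4; §4] -/
theorem Theil2006_groundStateEnergy_of_geometry {K C₃₄ C₉ K₃ : ℝ} (hK : 0 ≤ K)
    (hC₃₄ : 0 ≤ C₃₄) (hC₉ : 0 ≤ C₉) (hK₃ : 0 ≤ K₃)
    (hgeom : ∃ α₂ : ℝ, 0 < α₂ ∧ ∀ ⦃α : ℝ⦄, 0 < α → α < α₂ → ∀ ⦃V : ℝ → ℝ⦄, IsAdmissible α V →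
      ∀ {N : ℕ} (y : Fin N → Plane), (∀ i j : Fin N, i ≠ j → 1 - α < dist (y i) (y j)) →
      ∃ (TLall : Finset (Finset (Fin N))) (lamOf : Finset (Fin N) → ℝ),
        (∀ T ∈ TLall, lamOf T ∈ distSet \ {1}) ∧ (∀ T ∈ TLall, T.card = 3) ∧
        (∀ T ∈ TLall, ∀ x ∈ T, ∀ x' ∈ T, x ≠ x' →
          |dist (y x) (y x') / lamOf T - 1| ≤ K * α) ∧
        (∀ p ∈ (Finset.univ : Finset (Fin N × Fin N)).filter (fun p => p.1 < p.2) \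
            shortRangePairs α y, (TLall.filter fun T => p.1 ∈ T ∧ p.2 ∈ T).card ≤ 2) ∧
        (∀ p ∈ (Finset.univ : Finset (Fin N × Fin N)).filter (fun p => p.1 < p.2) \
            shortRangePairs α y, (TLall.filter fun T => p.1 ∈ T ∧ p.2 ∈ T).card < 2 →
            ∃ b ∈ defects α y, dist (y p.1) (y b) ≤ K₃ * dist (y p.1) (y p.2)) ∧
        (∀ lam : ↥(distSet \ {1}),
          (0 ≤ ((unitSimplices α y).card : ℝ) -
              1 / (m (lam : ℝ) : ℝ) * (TLall.filter fun T => lamOf T = lam).card ∧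
            ((unitSimplices α y).card : ℝ) -
              1 / (m (lam : ℝ) : ℝ) * (TLall.filter fun T => lamOf T = lam).card ≤
              C₉ * (lam : ℝ) ^ 2 * (defects α y).card) ∧
          (0 ≤ ∑ S ∈ unitSimplices α y, (volume (convexHull ℝ (y '' ↑S))).toReal -
              1 / ((lam : ℝ) ^ 2 * m (lam : ℝ)) *
                ∑ T ∈ TLall.filter (fun T => lamOf T = lam),
                  (volume (convexHull ℝ (y '' ↑T))).toReal ∧
            ∑ S ∈ unitSimplices α y, (volume (convexHull ℝ (y '' ↑S))).toReal -
              1 / ((lam : ℝ) ^ 2 * m (lam : ℝ)) *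
                ∑ T ∈ TLall.filter (fun T => lamOf T = lam),
                  (volume (convexHull ℝ (y '' ↑T))).toReal ≤
              C₉ * (lam : ℝ) ^ 2 * (defects α y).card) ∧
          (lam : ℝ)⁻¹ ^ 7 * ∑ T ∈ TLall.filter (fun T => lamOf T = lam),
              (1 / 2 * ∑ p ∈ T.offDiag, (dist (y p.1) (y p.2) - lam) ^ 2) ≤
            C₃₄ * (lam : ℝ)⁻¹ ^ 5 * Real.log (lam : ℝ) * m (lam : ℝ) *
              ∑ p ∈ shortRangePairs α y, (dist (y p.1) (y p.2) - 1) ^ 2)) :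
    Theil2006_groundStateEnergy := by
  obtain ⟨α₂, hα₂, hgeom⟩ := hgeom
  obtain ⟨α₀, hα₀, h9⟩ := exists_mainLocalEstimate_finite hK hC₃₄ hC₉ hK₃
  obtain ⟨αq, hαq, hquad⟩ := exists_quadratic_le_renormalizedPotential
  refine Theil2006_groundStateEnergy_of_mainEstimate ⟨min (min α₀ α₂) (min αq (1 / 5)),
    by positivity, fun α hα hαlt V hV N y hsep => ?_⟩
  have hα0' : α < α₀ := hαlt.trans_le ((min_le_left _ _).trans (min_le_left _ _))
  have hα2' : α < α₂ := hαlt.trans_le ((min_le_left _ _).trans (min_le_right _ _))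
  have hαq' : α < αq := hαlt.trans_le ((min_le_right _ _).trans (min_le_left _ _))
  have hα5 : α ≤ 1 / 5 := hαlt.le.trans ((min_le_right _ _).trans (min_le_right _ _))
  obtain ⟨TLall, lamOf, hl, h3, h25, h281, h283, hgl⟩ := hgeom hα hα2' hV y hsep
  have h := h9 hα hα0' hV y hsep TLall lamOf hl h3 h25 h281 h283 hgl
  -- the short-range and defect terms of (9) are non-negative
  have hpos : 0 ≤ ∑ p ∈ shortRangePairs α y,
      (renormalizedPotential V (dist (y p.1) (y p.2)) + 1) := by
    refine Finset.sum_nonneg fun p hp => ?_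
    obtain ⟨hlt, habs⟩ := mem_shortRangePairs_iff.1 hp
    obtain ⟨h1, h2⟩ := abs_le.1 (show |dist (y p.1) (y p.2) - 1| ≤ α from habs)
    have := hV.quadratic_le_renormalizedPotential_Ioc hα5 (hquad α V hα hαq' hV)
      ⟨hsep p.1 p.2 (ne_of_lt hlt), by linarith⟩
    nlinarith [sq_nonneg (dist (y p.1) (y p.2) - 1)]
  have hD : (0 : ℝ) ≤ (defects α y).card := Nat.cast_nonneg _
  linarith

end Literature.MathematicalPhysics.StatisticalMechanics

end
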